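import Summits.BirchSwinnertonDyer.Rank1Residual.X2.SplitHalvesOnTree
import HarnessLib

/-!
# O9 (row B11), BOTH signs: the HIDA-LIMIT road H to the IMC atom c3 — its output typed as ONE
# sign-free residual, the REVERSE one-sided divisibility `p^a · Ch_Λ(X_ac^∅)·R₀⟦T⟧ ⊆ (L)`, and the
# kernel glue "reverse divisibility + Keller–Yin D′ ⟹ c3 / c3s" (cell `bsd-eis`, seat
# `bsd-eis-cgshw` g7; route `EisensteinPrimes`, crux 4 `BSDpOnCellC`, line b1 stubs c3-div/c3-μλ and
# their split twins; memo `HOME/cgshw-MEMO-8.md` §4 H1–H3, §6, §11)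

HONEST FRAMING (cell `bsd-eis`, run/shared/lean/pub/bsd-eis/): theorems + ONE hypothesis-shaped
`@[conjecture]` predicate; nothing booked; X2 stays CONSTRUCTION-SHAPED; no label or count moves.

## The point of this file

The IMC atom c3 = `NonsplitIMCEqOnTree W p` (p404147) / c3s = `SplitIMCEqOnTree W p` (p416318) —
`Ch_Λ(X_ac^∅(E[p^∞]))·R₀⟦T⟧ = (L)` for every BDP frame `L` at an X2c Heegner datum — is reached
in the kernel from TWO typed halves: ONE divisibility c3-div / c3s-div («`∃ k, p^k·L ∈
Ch_Λ·R₀⟦T⟧`», the KOLYVAGIN direction: the characteristic series divides `p^k·L`; provenance road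
R-β = the weight-2 reducible Heegner-point Kolyvagin system at `p ‖ N` + Castella 2024) and
Keller–Yin D′ c3-μλ / c3s-μλ (`μ = 0` on both sides and `λ`-equality, as first unit coefficients at
the same index), glued by `nonsplitIMCEqOnTree_of_div_of_muLambda` (p408417) /
`splitIMCEqOnTree_of_div_of_muLambda` (p416318).

The HIDA-LIMIT road H (Keller–Yin arXiv:2402.12781v2 §5 = Thm. D, as repaired by bsd-eis-ky MEMO-2
§4 "Theorem D″" and kernel-checked over `Λ = ℤ_p⟦T⟧` as
`X2.KellerYinFreePartGap.charIdeal_eq_span_of_oneSided_congruences`, p397463) produces the OPPOSITE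
one-sided statement: from the congruent good-ordinary members `f_m` of the Hida family through
`f_E` — inputs (α) lattice congruences `T_{f_m}/ϖ^m ≅ T/ϖ^m` [NOT in print for residually reducible
`f`; ky MEMO-2 §5 reduced it to (HF′) "the normalised Eisenstein branch through `f_E` is factorial";
cgshw MEMO-9 derives it at memo level WITHOUT (HF′) from the étaleness of the ordinary family at the
p-new weight-2 point `f_E` (Hida 1986 Cor. 1.4; local analytic branch `𝒪⟦S′⟧` regular ⟹
Bellaïche–Chenevier Prop. 1.6.1 ⟹ Skinner's specialisation verbatim)], (b) the
two-variable `p`-adic `L`-function congruences `(𝓛_{f_m}) + (ϖ^m) = (𝓛_f) + (ϖ^m)` [Castella JIMJ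
2020 §1.5, image- and Gorenstein-free; rider `p ∤ h_K`], (d) the anticyclotomic IMC2 for every member
`f_m` [Keller–Yin Thm. 3.0.8, PREPRINT; its printed sources' weight-vs-`p` hypotheses
(Longo–Vigni Ass. 2.3, Castella–Hsieh (H)(a), root Nekovář 1992) are REMOVED at memo level by
cgshw MEMO-8 (bounded denominators absorbed member by member in KY's own closing step)] — the
one-sided congruence limit (Krull in `Λ^nr = R₀⟦T⟧`; kernel shape
`X11b.CongruenceLimitOneSided.fittingIdeal_le_span_of_congruences`) and the finite-submodule bound
`(p)^a · Ch ⊆ Fitt₀` give **`p^a · 𝓕 ∈ (L)`** for a generator `𝓕` of `Ch_Λ(X_ac^∅)` read in `R₀⟦T⟧`: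
the `p`-adic `L`-function DIVIDES `p^a ·` the characteristic series. This file TYPES that output as
ONE predicate, **sign-free** (KY §5 carries no sign hypothesis: the members share `f`'s local type,
`{ωδ̄, δ̄}` at a non-split `p`, the anomalous `{ω, 𝟙}·unr` at a split `p`, and KY §§1–3 allow both —
MEMO-8 §5), and proves that it closes c3 AND c3s against the SAME D′ halves, by the SAME `R₀⟦T⟧`
algebra (`span_singleton_eq_of_C_pow_mul_mem`, p406792) with the roles of `𝓕` and `L` exchanged.

## Contents

* `HidaLimitRevDivOnTree W p` (`@[conjecture]`, hypothesis-shaped): at every X2c Heegner datum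
  (NO sign binder), every frame `L` with `IsBDPLFunction`, and every generator `𝓕` of `Ch_Λ(X_ac^∅)`:
  `∃ a, p^a · 𝓕 ∈ (L)` in `R₀⟦T⟧`. NOT in print (road H's residual inputs are (α) and KY's PRE
  status); TYPED, not attempted.
* `hidaLimitRevDivOnTree_of_imcEq` — consistency: c3 ∧ c3s ⟹ the predicate (with `a = 0`); so it
  is INTERMEDIATE between the target and nothing, never stronger than c3 ∧ c3s.
* `nonsplitIMCEqOnTree_of_hidaLimitRevDiv_of_muLambda`,
  `splitIMCEqOnTree_of_hidaLimitRevDiv_of_muLambda` — THE GLUE: reverse divisibility + D′ ⟹ c3,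
  resp. c3s. So each of c3, c3s has two typed roads with DISJOINT provenance of the divisibility half
  (R-β: Kolyvagin at weight 2; H: Hida limit) and the SAME D′ half.

FRAMES (planner RULING L9-a (r1)): `HidaLimitRevDivOnTree` is hypothesis-shaped over `R₀`-frames
`(Ω_K, Ω_p ∈ R₀ˣ, L ∈ R₀⟦T⟧)` with `IsBDPLFunction`, exactly like c3/c3s; it is CONSUMED ONLY TOGETHER
WITH such an `R₀`-frame. At a non-split `p` no `R₀`-frame is known to exist without the `R₀`-descent
residual `HsiehFrameResidualAt` (retired on the ¬split road of record, which now runs over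
`𝓞_{ℂ_p}`-frames: k5-c4, `X2/NonsplitBDPExistsInt.lean`, p418462, `NonsplitIMCEqOnTreeInt` = c3♭), so on
that branch the predicate and its glue output `NonsplitIMCEqOnTree` are vacuous until an `R₀`-frame is
supplied; road H's own frame source is the weight-2 p-new specialisation of Castella's two-variable
BDP function over the Hida family (Castella, JIMJ 19 (2020) §1.5, Def. 1.3 / Thm. 1.4 (i) = Keller–Yin
§5 (b)), which lives in `Λ^nr = R₀⟦T⟧`; the `𝓞_{ℂ_p}⟦T⟧` twins (`HidaLimitRevDivOnTreeInt` + glue to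
c3♭) are owed as a follow-up file once p418462 lands (RULING L9-a (r2)). At a split `p` the `R₀` form
matches g6's `SplitIMCEqOnTree` (p416318).

What this is NOT: not a proof of either divisibility; no statement about the control atom CTL (g6),
about the value atom c2, or about the cyclotomic main conjecture; (α) is argued at memo level in
cgshw MEMO-9, not here; the registered stubs of line b1 are untouched (RULING L7: they stay as
typed; this file adds an alternative, it replaces nothing).

References: [KellerYin2024] §5, Thm. 5.1.3 = Thm. D, Thm. 3.0.8 (arXiv:2402.12781v2; PRE); [Hida1986] Cor. 1.4 (Invent. 85);
[Skinner2016PacificMC] §3.1; [Castella2018Erratum] proof of Thm. 1.1 (p. 4) (the one-sided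
congruence-limit shape); [Washington1997] §7.1, §13.2; cell memos bsd-eis-ky MEMO-2 §§2–5,
cgshw MEMO-8.
-/

set_option autoImplicit false

noncomputable section

open scoped Classical MatrixGroups ModularForm

open CongruenceSubgroup WeierstrassCurve NumberField IsDedekindDomain Field PowerSeries
  Literature.NumberTheory.EllipticCurves Literature.NumberTheory.EllipticCurves.GreenbergSelmer
  Literature.NumberTheory.EllipticCurves.ModularForms
  Literature.NumberTheory.EllipticCurves.Rank1Residual
  Literature.NumberTheory.EllipticCurves.Rank1Residual.Typed
  Literature.NumberTheory.GaloisRepresentations Literature.NumberTheory.GaloisCohomology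
  Literature.NumberTheory.Automorphic
  Summit.BirchSwinnertonDyer.Rank1Residual.X11b.AcSelmer
  Summit.BirchSwinnertonDyer.Rank1Residual.X11b.Halves
  Summit.BirchSwinnertonDyer.Rank1Residual.X11b
  Summit.BirchSwinnertonDyer.Rank1Residual.X1.KellerYinHalves

namespace Summit.BirchSwinnertonDyer.Rank1Residual.X2

section Residual

variable (W : WeierstrassCurve ℚ) [W.IsElliptic] [W.IsGloballyMinimal] (p : ℕ) [Fact p.Prime]

/-- **`HidaLimitRevDivOnTree W p` — the output of the Hida-limit road H to the IMC atom, BOTH signs: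
the REVERSE one-sided divisibility "`p^a · Ch_Λ(X_ac^∅(E[p^∞]))·R₀⟦T⟧ ⊆ (L)`".** On the data of
`NonsplitIMCEqOnTree` / `SplitIMCEqOnTree` WITHOUT the sign binder — an X2c pair (`CellC W p`:
`E[p]` reducible, `p` odd multiplicative, analytic rank one), level `N = N_E`, `K` imaginary
quadratic with `d_K < −4`, the Heegner hypothesis for `N`, `L(E^{d_K}, 1) ≠ 0`, a Heegner datum
with `p ∤ c` and non-torsion point, an anticyclotomic `κ` with generator `γ`, a degree-one `𝔭 ∋ p`,
the newform, an embedding datum inducing `𝔭`, a BDP frame `(Ω_K, Ω_p, L)` — and every generator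
`𝓕` of `Ch_Λ(X_ac^∅(E[p^∞]))`: for some `a`, `p^a · 𝓕 ∈ (L)` in `R₀⟦T⟧` (the `p`-adic
`L`-function DIVIDES `p^a` times the characteristic series — the direction OPPOSITE to the Kolyvagin
halves `NonsplitKolyvaginDivOnTree` / `SplitKolyvaginDivOnTree`). PROVENANCE (road H; NOT in print):
Keller–Yin v2 §5 (a)–(e) at `p ‖ N` (no sign hypothesis; Thm. C / Thm. 5.1.3 «p ‖ N an odd
Eisenstein prime of multiplicative reduction») as repaired by bsd-eis-ky MEMO-2 §4 (Thm. D″; kernel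
`X2.KellerYinFreePartGap.charIdeal_eq_span_of_oneSided_congruences` over `ℤ_p⟦T⟧`, here needed over
`Λ^nr = R₀⟦T⟧`): the one-sided congruence limit (`X11b.CongruenceLimitOneSided.fittingIdeal_le_span_of_congruences`
shape; Krull) applied to `(p)^a·Ch ⊆ Fitt₀(X_ac^∅)` (`a` = exponent of the finite submodule), the
quotient isomorphisms `X_ac^∅/p^m ≅ 𝔛_{f_m}/p^m` [(α): lattice congruences `T_{f_m}/ϖ^m ≅ T/ϖ^m`,
NOT in print for residually reducible `f`; ky MEMO-2 §5 I3: ⟸ (HF′); cgshw MEMO-9: at memo level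
from the étaleness of the ordinary family at `f_E` (Hida, Invent. 85 (1986) Cor. 1.4; the completed
local analytic branch `𝒪⟦S′⟧` is regular, so Bellaïche–Chenevier Prop. 1.6.1 gives a free lattice
and Skinner's specialisation runs verbatim — no Gorenstein, no (HF′)); + anticyclotomic control],
the member inclusions
`Fitt₀(𝔛_{f_m}) ⊆ (𝓛_{f_m})` [(d): KY Thm. 3.0.8 (IMC2) for the good-ordinary members `f_m ∈
S_{k_m}(Γ₀(N/p))`, `k_m ≡ 2 (mod 2(p−1))`, PREPRINT — its printed sources' weight-vs-`p` hypotheses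
removed by cgshw MEMO-8 (bounded denominators, absorbed member by member)] and the congruences
`(𝓛_{f_m}) + (p^m) = (𝓛_f) + (p^m)` [(b): Castella JIMJ 19 (2020) §1.5 two-variable BDP function,
image-free; rider `p ∤ h_K`] — with KY's `𝓛_f ∈ Λ^nr` identified with the frame `L` (unique up to
`R₀^×`, `X11b/BDPFrameUniqueness`) and KY's `𝔛_f` with `X_ac^∅` up to finite local terms (the
transport already in c3's provenance). FRAMES: hypothesis-shaped over `R₀`-frames — consumed only
together with an `R₀`-frame (road H's own: the weight-2 specialisation of [Cas20 §1.5]'s two-variable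
function, in `Λ^nr = R₀⟦T⟧`); at a non-split `p` the road of record now runs over `𝓞_{ℂ_p}`-frames
(k5-c4, p418462) and the `Int` twin of this predicate is owed (planner RULING L9-a). A predicate on
`(W, p)`; TYPED, not attempted; nothing asserted; every result using it is CONDITIONAL. [claim: KellerYin2024, status: under-review]
[cite: KellerYin2024, §5.1 (a)–(e), Lemma 5.1.2, Thm. 5.1.3 = Thm. D and Thm. 3.0.8 (arXiv:2402.12781v2)]
[cite: Skinner2016PacificMC, §3.1 (p. 192) (shape of the congruence limit)]
[cite: Castella2018Erratum, proof of Thm. 1.1 (p. 4) (one-sided congruence-limit shape)] -/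
@[conjecture]
def HidaLimitRevDivOnTree : Prop :=
  ∀ (N : ℕ) [NeZero N] (K : Type) [Field K] [NumberField K] (Dt : ModularParametrizationData W N)
    (H : HeegnerDatum N (NumberField.discr K)) (ιK : K →+* ℂ) (P : (W.baseChange K).toAffine.Point),
    CellC W p → W.conductorNorm ℤ = N →
    IsImaginaryQuadratic K → NumberField.discr K < -4 → SatisfiesHeegnerHypothesis N K →
    (W.quadraticTwist (NumberField.discr K : ℚ)).entireLFunction 1 ≠ 0 →
    WeierstrassCurve.Affine.Point.map ιK.toRatAlgHom P = heegnerPointComplex Dt H →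
    ¬ (p : ℤ) ∣ Dt.c → ¬ IsOfFinAddOrder P →
    ∀ (κ : ZpExtension K p), κ.IsAnticyclotomic →
      ∀ (γ : Field.absoluteGaloisGroup K) [Fact (κ.IsTopGenerator γ)]
        (𝔭 : HeightOneSpectrum (𝓞 K)), ((p : ℕ) : 𝓞 K) ∈ 𝔭.asIdeal →
        𝔭.asIdeal.ramificationIdx (𝓞 ℚ) = 1 → 𝔭.asIdeal.inertiaDeg (𝓞 ℚ) = 1 →
        ∀ (f : CuspForm (CongruenceSubgroup.Gamma0 N) 2), IsNewformOf W f →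
          ∀ (ι' : PadicAlgCl p ≃+* ℂ),
            (∀ (w : InfinitePlace K) (k : 𝓞 K),
              k ∈ 𝔭.asIdeal ↔ ‖ι'.symm (w.embedding (k : K))‖ < 1) →
            ∀ (ΩK : ℂ) (Ωp : (unrIntegers p)ˣ) (L : UnrSeries p), ΩK ≠ 0 →
              IsBDPLFunction ι' 𝔭 κ γ f ΩK ((Ωp : unrIntegers p) : ℂ_[p]) L →
                ∀ F : IwasawaAlgebra p,
                  XAc.charIdeal (W.baseChange K) p κ 𝔭 ∅ γ = Ideal.span {F} →
                  ∃ a : ℕ, PowerSeries.C ((p : unrIntegers p) ^ a) * PowerSeries.map (toUnr p) F ∈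
                    Ideal.span ({L} : Set (UnrSeries p))

end Residual

/-! ### Consistency: the target implies the residual (so the residual is never STRONGER than c3 ∧ c3s) -/

section Consistency

variable {W : WeierstrassCurve ℚ} [W.IsElliptic] [W.IsGloballyMinimal] {p : ℕ} [Fact p.Prime]

omit [W.IsElliptic] [W.IsGloballyMinimal] in
/-- **c3 ∧ c3s ⟹ `HidaLimitRevDivOnTree`** (with `a = 0`): if `Ch_Λ(X_ac^∅)·R₀⟦T⟧ = (L)` then the
image of any generator lies in `(L)`. Case split on the reduction sign only to pick the half of the
hypothesis that applies; no arithmetic. [folklore] -/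
theorem hidaLimitRevDivOnTree_of_imcEq (hns : NonsplitIMCEqOnTree W p)
    (hs : SplitIMCEqOnTree W p) : HidaLimitRevDivOnTree W p := by
  intro N _ K _ _ Dt H ιK P hc hN hK hd4 hHN hLt hP hcM hPinf κ hκ γ _ 𝔭 h𝔭 he hf f hfW ι' hι'
    ΩK Ωp L hΩK hL F hchar
  have himc : R1.IMCEqOnTreeAt W p κ 𝔭 γ L := by
    by_cases hsp : W.HasSplitMultiplicativeReductionAtPrime p
    · exact hs N K Dt H ιK P hc hsp hN hK hd4 hHN hLt hP hcM hPinf κ hκ γ 𝔭 h𝔭 he hf f hfW ι' hι'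
        ΩK Ωp L hΩK hL
    · exact hns N K Dt H ιK P hc hsp hN hK hd4 hHN hLt hP hcM hPinf κ hκ γ 𝔭 h𝔭 he hf f hfW ι' hι'
        ΩK Ωp L hΩK hL
  refine ⟨0, ?_⟩
  unfold R1.IMCEqOnTreeAt at himc
  rw [hchar, Ideal.map_span, Set.image_singleton] at himc
  rw [pow_zero, map_one, one_mul, ← himc]
  exact Ideal.subset_span rfl

end Consistency

/-! ### THE GLUE: reverse divisibility (road H) + Keller–Yin D′ ⟹ c3 (non-split) and c3s (split) -/

section Glue

variable {W : WeierstrassCurve ℚ} [W.IsElliptic] [W.IsGloballyMinimal] {p : ℕ} [Fact p.Prime]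

omit [W.IsElliptic] [W.IsGloballyMinimal] in
/-- **Road H closes c3**: `HidaLimitRevDivOnTree` (`p^a·𝓕 ∈ (L)`) + `NonsplitMuLambdaOnTree` (first
unit coefficients of `𝓕` and `L` at the same index) ⟹ `NonsplitIMCEqOnTree W p`
(`Ch_Λ(X_ac^∅)·R₀⟦T⟧ = (L)` at every non-split X2c Heegner datum) — the `R₀⟦T⟧` algebra
`span_singleton_eq_of_C_pow_mul_mem` (p406792) with the roles of `𝓕` and `L` EXCHANGED relative to
`nonsplitIMCEqOnTree_of_div_of_muLambda` (p408417), and the principality of characteristic ideals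
(`charIdeal_isPrincipal_holds`). CONDITIONAL on the two typed hypotheses; nothing booked.
[cite: KellerYin2024, proof of Thm. 3.0.8 (TeX L1651–1653: the closing by μ = 0 and λ) and Lemma 5.1.2]
[cite: Washington1997, §7.1 Prop. 7.2] -/
theorem nonsplitIMCEqOnTree_of_hidaLimitRevDiv_of_muLambda (hrev : HidaLimitRevDivOnTree W p)
    (hml : NonsplitMuLambdaOnTree W p) : NonsplitIMCEqOnTree W p := by
  intro N _ K _ _ Dt H ιK P hc hns hN hK hd4 hHN hLt hP hcM hPinf κ hκ γ _ 𝔭 h𝔭 he hf f hfW ι' hι'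
    ΩK Ωp L hΩK hL
  obtain ⟨F, hF⟩ :=
    (charIdeal_isPrincipal_holds p (XAc (W.baseChange K) p κ 𝔭 ∅ γ)).principal
  have hchar : XAc.charIdeal (W.baseChange K) p κ 𝔭 ∅ γ = Ideal.span {F} := hF
  obtain ⟨a, ha⟩ := hrev N K Dt H ιK P hc hN hK hd4 hHN hLt hP hcM hPinf κ hκ γ 𝔭 h𝔭 he hf f hfW
    ι' hι' ΩK Ωp L hΩK hL F hchar
  obtain ⟨n, hFn, hLn⟩ := hml N K Dt H ιK P hc hns hN hK hd4 hHN hLt hP hcM hPinf κ hκ γ 𝔭 h𝔭 he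
    hf f hfW ι' hι' ΩK Ωp L hΩK hL F hchar
  unfold R1.IMCEqOnTreeAt
  rw [hchar, Ideal.map_span, Set.image_singleton]
  exact (span_singleton_eq_of_C_pow_mul_mem ha hLn hFn).symm

omit [W.IsElliptic] [W.IsGloballyMinimal] in
/-- **Road H closes c3s**: `HidaLimitRevDivOnTree` + `SplitMuLambdaOnTree` ⟹ `SplitIMCEqOnTree W p`
(`Ch_Λ(X_ac^∅)·R₀⟦T⟧ = (L)` at every SPLIT X2c Heegner datum) — same algebra, the split D′ half
of p416318. The Hida-limit road is sign-free (Keller–Yin §5; at a split `p` the members have the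
anomalous local type `{ω, 𝟙}·unr`, which KY §§1–3 allow), so ONE residual serves both signs.
CONDITIONAL on the two typed hypotheses; nothing booked.
[cite: KellerYin2024, §5.1 and Thm. 5.1.3 = Thm. D (arXiv:2402.12781v2), no sign hypothesis]
[cite: Washington1997, §7.1 Prop. 7.2] -/
theorem splitIMCEqOnTree_of_hidaLimitRevDiv_of_muLambda (hrev : HidaLimitRevDivOnTree W p)
    (hml : SplitMuLambdaOnTree W p) : SplitIMCEqOnTree W p := by
  intro N _ K _ _ Dt H ιK P hc hs hN hK hd4 hHN hLt hP hcM hPinf κ hκ γ _ 𝔭 h𝔭 he hf f hfW ι' hι'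
    ΩK Ωp L hΩK hL
  obtain ⟨F, hF⟩ :=
    (charIdeal_isPrincipal_holds p (XAc (W.baseChange K) p κ 𝔭 ∅ γ)).principal
  have hchar : XAc.charIdeal (W.baseChange K) p κ 𝔭 ∅ γ = Ideal.span {F} := hF
  obtain ⟨a, ha⟩ := hrev N K Dt H ιK P hc hN hK hd4 hHN hLt hP hcM hPinf κ hκ γ 𝔭 h𝔭 he hf f hfW
    ι' hι' ΩK Ωp L hΩK hL F hchar
  obtain ⟨n, hFn, hLn⟩ := hml N K Dt H ιK P hc hs hN hK hd4 hHN hLt hP hcM hPinf κ hκ γ 𝔭 h𝔭 he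
    hf f hfW ι' hι' ΩK Ωp L hΩK hL F hchar
  unfold R1.IMCEqOnTreeAt
  rw [hchar, Ideal.map_span, Set.image_singleton]
  exact (span_singleton_eq_of_C_pow_mul_mem ha hLn hFn).symm

omit [W.IsElliptic] [W.IsGloballyMinimal] in
/-- **The two roads meet**: at either sign, the Kolyvagin half (c3-div / c3s-div: `𝓕 ∣ p^k L`) and
the Hida-limit half (`L ∣ p^a 𝓕`) TOGETHER already give `(𝓕) = (L)` up to `p`-power torsion on
both sides — recorded here only in the form the tree uses: with D′ available, EITHER half suffices
(`nonsplitIMCEqOnTree_of_div_of_muLambda` / `…_of_hidaLimitRevDiv_of_muLambda`), so the IMC atom at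
both signs is `(c3-div ∨ HidaLimitRevDiv) ∧ c3-μλ`, `(c3s-div ∨ HidaLimitRevDiv) ∧ c3s-μλ`.
CONDITIONAL; nothing booked. [folklore] -/
theorem imcEq_both_signs_of_div_or_hidaLimitRevDiv_of_muLambda
    (hdiv : (NonsplitKolyvaginDivOnTree W p ∧ SplitKolyvaginDivOnTree W p) ∨ HidaLimitRevDivOnTree W p)
    (hml : NonsplitMuLambdaOnTree W p) (hmls : SplitMuLambdaOnTree W p) :
    NonsplitIMCEqOnTree W p ∧ SplitIMCEqOnTree W p := by
  rcases hdiv with ⟨hd, hds⟩ | hrev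
  · exact ⟨nonsplitIMCEqOnTree_of_div_of_muLambda hd hml,
      splitIMCEqOnTree_of_div_of_muLambda hds hmls⟩
  · exact ⟨nonsplitIMCEqOnTree_of_hidaLimitRevDiv_of_muLambda hrev hml,
      splitIMCEqOnTree_of_hidaLimitRevDiv_of_muLambda hrev hmls⟩

end Glue

end Summit.BirchSwinnertonDyer.Rank1Residual.X2

end
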